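import Summits.QuantumAdvantage.QuantumAdvantage.Theses.DarkClassGroups
import Literature.NumberTheory.QuadraticFields.QuadraticDedekindZetaZeros
import Literature.NumberTheory.QuadraticFields.JacobiCharacterPrimitiveProofs
import Literature.NumberTheory.QuadraticFields.ImaginaryResidueClassNumber
import Literature.NumberTheory.DiophantineGeometry.AbcWave0GranvilleStarkTheorem2Proofs
import Literature.NumberTheory.LFunctions.UniformClassGroupPNTGeneralDegreeInputs
import Literature.NumberTheory.LFunctions.UniformClassGroupPNTInputs
import HarnessLib

/-!
# Crux `PrimeClassesSpread` (stmt-QuantumAdvantage-11613) — the three field-theoretic inputs for an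
# imaginary quadratic field: odd primitive Kronecker character, no real zero of `ζ_K` near `1` under (i),
# and the residue bound `κ_K ≥ Q^{−1}`

Topic `Summits/QuantumAdvantage/QuantumAdvantage/Theorems`, helper for the crux `PrimeClassesSpread`
(stmt-QuantumAdvantage-11613) of route `DarkClassGroups`.
HONEST FRAMING: the value of this file is a THEOREM (kernel-checked inputs) — not summit progress.

The crux is proved (sibling files) by the one-sided Linnik machinery of the cell `linnik-cubic`
(route `LinnikCubicClassGroups`, crux `DegreeOnePrimesEscape`) at degree `2`: the per-character deficit
`perCharacterDeficitκ_of_le_four 2` and the lower prime ideal theorem dichotomy `lowerPITκ_of_le_three 2`,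
both for fields with `κ_K ≥ Q^{−A}` (`Q = 4|d_K|`), plus a zero-free interval for `ζ_K` to exclude the
nearby-zero alternative.  This file supplies, for an IMAGINARY QUADRATIC field `K`:

* `exists_oddKroneckerChar` — a Dirichlet character `κ` modulo `|d_K|` which is quadratic, PRIMITIVE,
  ODD and `≠ 1`, with `ζ_K(s) = ζ(s) L(s, κ)` on `Re s > 1` (the tree's `exists_kroneckerChar` with the
  three extra properties: `isPrimitive_jacobiChar` / `jacobiChar_neg_one_of_mod_four_eq_three` for odd
  `d_K`, `isPrimitive_of_forall_odd` / `apply_neg_one_of_forall_odd` for `d_K = 4m`);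
* `zetaCont_ne_zero_of_noSiegel` — under hypothesis (i)
  `Summit.RiemannHypothesis.RiemannHypothesis.NoSiegelZerosOddQuadratic` there is an absolute `c ∈ (0, 1/4]`
  with `ζ_K(σ) ≠ 0` for `1 − c/log|d_K| < σ < 1` and every imaginary quadratic `K`
  (`ζ_K = ζ · L(·, κ)` off `s = 1`, `ζ(σ) < 0` on `(0,1)`, and (i) for the odd primitive quadratic `κ`);
* `condQn_rpow_neg_one_le_residue` — `κ_K ≥ Q^{−1}` for `d_K < −4` (class number formula
  `κ_K = 2π h_K/(w_K √|d_K|)`, `w_K = 2`, `h_K ≥ 1`).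
-/

noncomputable section

open scoped NumberField
open Literature.NumberTheory.LFunctions Literature.NumberTheory.LFunctions.NumberField
  Literature.NumberTheory.QuadraticFields Literature.NumberTheory.QuadraticFields.Quadratic

namespace Summit.QuantumAdvantage.QuantumAdvantage.Theorems.PrimeClassesSpread

open scoped NumberTheorySymbols in
/-- **The Kronecker character of an imaginary quadratic field is an odd primitive quadratic Dirichlet
character modulo `|d_K|`** with `ζ_K(s) = ζ(s) L(s, κ)` for `Re s > 1`.
[cite: MontgomeryVaughan2007, Theorem 9.13; §10.1 Exercise 26] -/
theorem exists_oddKroneckerChar (K : Type) [Field K] [NumberField K] (h2 : Module.finrank ℚ K = 2)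
    (hc : NumberField.IsTotallyComplex K) :
    ∃ (M : ℕ) (_ : NeZero M) (κ : DirichletCharacter ℂ M), M = (NumberField.discr K).natAbs ∧ κ ≠ 1 ∧
      κ.IsQuadratic ∧ κ.IsPrimitive ∧ κ.Odd ∧
      ∀ s : ℂ, 1 < s.re → NumberField.dedekindZeta K s = riemannZeta s * LSeries (fun n ↦ κ n) s := by
  have hneg : NumberField.discr K < 0 := discr_neg_of_isTotallyComplex h2 hc
  rcases isFundamentalDiscriminant_discr (K := K) h2 with ⟨h1, hsqf, -⟩ | ⟨h4, hm4, hsq⟩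
  · -- odd discriminant: `κ = (· / |d_K|)`, primitive since `|d_K|` is odd and square-free, odd since
    -- `|d_K| = −d_K ≡ 3 (mod 4)`
    have hodd : Odd (NumberField.discr K) := by rw [Int.odd_iff]; omega
    have hoddN : Odd (NumberField.discr K).natAbs := Int.natAbs_odd.mpr hodd
    have hsqN : Squarefree (NumberField.discr K).natAbs := Int.squarefree_natAbs.mpr hsqf
    have hmod3 : (NumberField.discr K).natAbs % 4 = 3 := by omega
    exact ⟨(NumberField.discr K).natAbs, inferInstance, jacobiChar (NumberField.discr K).natAbs, rfl,
      jacobiChar_natAbs_discr_ne_one h2 hodd, fun a ↦ jacobiChar_trichotomy a,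
      isPrimitive_jacobiChar hoddN hsqN, jacobiChar_neg_one_of_mod_four_eq_three hmod3,
      fun s hs ↦ dedekindZeta_eq_riemannZeta_mul_LSeries h2 hodd hs⟩
  · -- even discriminant `d = 4m`, `m < 0`
    set m : ℤ := NumberField.discr K / 4 with hm
    have hm0 : m ≠ 0 := hsq.ne_zero
    have hdm : NumberField.discr K = 4 * m := by rw [hm, Int.mul_ediv_cancel' h4]
    have hmneg : m < 0 := by omega
    haveI : NeZero (4 * m.natAbs) := ⟨mul_ne_zero (by norm_num) (Int.natAbs_ne_zero.mpr hm0)⟩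
    obtain ⟨κ, hκ⟩ := exists_dirichletCharacter_four_mul m hm0
    have hprim : κ.IsPrimitive := isPrimitive_of_forall_odd hm4 hsq hκ
    have hM : 4 * m.natAbs = (NumberField.discr K).natAbs := by
      rw [hdm, Int.natAbs_mul]; rfl
    have hne : κ ≠ 1 := by
      intro h
      have hcd : κ.conductor = 4 * m.natAbs := hprim
      rw [h, DirichletCharacter.conductor_one] at hcd
      have := Int.natAbs_pos.mpr hm0
      omega
    refine ⟨4 * m.natAbs, inferInstance, κ, hM, hne, isQuadratic_of_forall_odd hm0 hκ, hprim,
      apply_neg_one_of_forall_odd hmneg hm4 hκ, fun s hs ↦ ?_⟩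
    refine dedekindZeta_eq_riemannZeta_mul_LSeries_of_kronecker h2 κ (fun p hp hp2 ↦ ?_) ?_ hs
    · have hpodd : Odd p := hp.odd_of_ne_two hp2
      rw [hκ p hpodd, hdm, jacobiSym.mul_left]
      have h4' : J(4 | p) = 1 := by
        rw [show (4 : ℤ) = 2 ^ 2 by norm_num]
        exact jacobiSym.sq_one' (by
          rw [show (2 : ℤ) = ((2 : ℕ) : ℤ) by rfl, Int.gcd_natCast_natCast]
          exact (Nat.coprime_primes Nat.prime_two hp).mpr (Ne.symm hp2))
      rw [h4', one_mul]
    · have h81 : NumberField.discr K % 8 ≠ 1 := by omega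
      have h85 : NumberField.discr K % 8 ≠ 5 := by omega
      rw [if_neg h81, if_neg h85]
      refine apply_eq_zero_of_even (m := m) ?_
      have hlt : 2 < 4 * m.natAbs := by have := Int.natAbs_pos.mpr hm0; omega
      have : ((2 : ℕ) : ZMod (4 * m.natAbs)) = 2 := by norm_cast
      rw [← this, ZMod.val_natCast, Nat.mod_eq_of_lt hlt]
      exact even_two

/-- **Under (i), `ζ_K` of an imaginary quadratic field has no real zero in `(1 − c/log|d_K|, 1)`**
with an absolute `c ∈ (0, 1/4]`: `ζ_K(σ) = ζ(σ) L(σ, κ)` for the odd primitive quadratic Kronecker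
character `κ` mod `|d_K|` (`exists_oddKroneckerChar`, `dedekindZetaCont_eq_zero_iff`), `ζ(σ) ≠ 0` on
`(0, 1)`, and `L(σ, κ) ≠ 0` for `σ > 1 − c/log|d_K|` is hypothesis (i) at `q = |d_K| ≥ 3`. -/
theorem zetaCont_ne_zero_of_noSiegel
    (hi : Summit.RiemannHypothesis.RiemannHypothesis.NoSiegelZerosOddQuadratic) :
    ∃ c : ℝ, 0 < c ∧ c ≤ 1 / 4 ∧ ∀ (K : Type) [Field K] [NumberField K], Module.finrank ℚ K = 2 →
      NumberField.IsTotallyComplex K →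
      ∀ σ : ℝ, 1 - c / Real.log ((NumberField.discr K).natAbs : ℝ) < σ → σ < 1 →
        dedekindZetaCont K σ ≠ 0 := by
  obtain ⟨c, hc, H⟩ := hi
  refine ⟨min c (1 / 4), by positivity, min_le_right _ _, fun K _ _ h2 hK σ hσ hσ1 ↦ ?_⟩
  obtain ⟨M, _, κ, hM, hκ1, hquad, hprim, hoddκ, hfac⟩ := exists_oddKroneckerChar K h2 hK
  -- sizes: `|d_K| ≥ 3`, so `log|d_K| > 1` and `σ > 0`
  have hd3 : (3 : ℝ) ≤ ((NumberField.discr K).natAbs : ℝ) := by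
    have h := NumberField.abs_discr_gt_two (K := K) (by rw [h2]; norm_num)
    rw [Nat.cast_natAbs]
    exact_mod_cast (show (3 : ℤ) ≤ |NumberField.discr K| by omega)
  have hM3 : 3 ≤ M := by rw [hM]; exact_mod_cast hd3
  have hlog1 : 1 < Real.log ((NumberField.discr K).natAbs : ℝ) := by
    rw [Real.lt_log_iff_exp_lt (by linarith)]
    have := Real.exp_one_lt_d9; linarith
  have hσ0 : 0 < σ := by
    have h1 : min c (1 / 4) / Real.log ((NumberField.discr K).natAbs : ℝ) ≤ 1 / 4 := by
      rw [div_le_iff₀ (by linarith)]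
      have := min_le_right c (1 / 4)
      nlinarith
    linarith
  have hσc : 1 - c / Real.log (M : ℝ) < σ := by
    have hMR : (M : ℝ) = ((NumberField.discr K).natAbs : ℝ) := by rw [hM]
    rw [hMR]
    have h1 : min c (1 / 4) / Real.log ((NumberField.discr K).natAbs : ℝ) ≤
        c / Real.log ((NumberField.discr K).natAbs : ℝ) :=
      div_le_div_of_nonneg_right (min_le_left _ _) (by linarith)
    linarith
  have hs1 : ((σ : ℝ) : ℂ) ≠ 1 := by
    intro h
    have : σ = 1 := by exact_mod_cast h
    linarith
  rw [Ne, dedekindZetaCont_eq_zero_iff (K := K) hκ1 hfac hs1, not_or]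
  exact ⟨riemannZeta_ofReal_ne_zero_of_pos_of_lt_one σ hσ0 hσ1, H M hM3 κ hquad hprim hoddκ σ hσc⟩

/-- **`κ_K ≥ Q^{−1}` for an imaginary quadratic field with `d_K < −4`** (`Q = |d_K| · 2² = 4|d_K|`): by the
class number formula `κ_K = 2π h_K/(w_K √|d_K|)` with `w_K = 2` and `h_K ≥ 1`,
`κ_K ≥ π/√|d_K| ≥ 1/(4|d_K|)`. [cite: NeukirchANT1999, Ch. VII §5 (5.11)] -/
theorem condQn_rpow_neg_one_le_residue (K : Type) [Field K] [NumberField K] (h2 : Module.finrank ℚ K = 2)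
    (hd4 : NumberField.discr K < -4) :
    ThornerZaman.condQn K ^ (-(1 : ℝ)) ≤ NumberField.dedekindZeta_residue K := by
  have hneg : NumberField.discr K < 0 := by omega
  have hw : NumberField.Units.torsionOrder K = 2 :=
    Literature.NumberTheory.DiophantineGeometry.torsionOrder_eq_two_of_discr_lt h2 hd4
  have hres := dedekindZeta_residue_eq_of_discr_neg (K := K) h2 hneg
  rw [hw] at hres
  set d : ℝ := |(NumberField.discr K : ℝ)| with hd
  have hd4' : (4 : ℝ) < d := by
    rw [hd]
    have : ((NumberField.discr K : ℤ) : ℝ) < -4 := by exact_mod_cast hd4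
    rw [abs_of_neg (by linarith)]
    linarith
  have hdpos : 0 < d := by linarith
  have hQ : ThornerZaman.condQn K = d * 4 := by
    rw [ThornerZaman.condQn, h2, hd]; norm_num
  have hh1 : (1 : ℝ) ≤ (NumberField.classNumber K : ℝ) := by
    exact_mod_cast NumberField.classNumber_pos (K := K)
  have hsqrt_pos : 0 < Real.sqrt d := Real.sqrt_pos.mpr hdpos
  have hsqrt_le : Real.sqrt d ≤ d := by
    rw [Real.sqrt_le_left (by linarith)]
    nlinarith
  -- `Q^{-1} = 1/(4d) ≤ π h/√d`
  push_cast at hres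
  rw [hQ, Real.rpow_neg (by positivity), Real.rpow_one, hres, le_div_iff₀ (by positivity)]
  have hpi : (3 : ℝ) < Real.pi := Real.pi_gt_three
  calc (d * 4)⁻¹ * (2 * Real.sqrt d) ≤ (d * 4)⁻¹ * (2 * d) := by gcongr
    _ = 1 / 2 := by field_simp; ring
    _ ≤ 2 * Real.pi * (NumberField.classNumber K : ℝ) := by nlinarith

end Summit.QuantumAdvantage.QuantumAdvantage.Theorems.PrimeClassesSpread

end
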